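import Summits.BirchSwinnertonDyer.Rank1Residual.X5.SelmerSolitaire
import HarnessLib

/-!
# X5 / O1 (p = 2), lens-2 "Selmer solitaire": the explicit one-vertex extension `extend P N` of a
# position by a neighbourhood vector, and its bookkeeping (plumbing for T4 = stub₂′)

HONEST FRAMING (cell `b2b-bsdres`, run/shared/lean/b2b/bsd-rank1-residual/, verbatim in every
file): the goal of the cell is to DELETE the COMBINATION-SHAPED residual classes of the
Birch–Swinnerton-Dyer formula for ALL analytic-rank `≤ 1` elliptic curves over `ℚ` — assembled
STRICTLY from published theorems — so that the rank-`≤ 1` remainder becomes exactly the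
CONSTRUCTION-SHAPED classes, which are TYPED (missing-input `Prop`s), NOT attempted. This is not
"finishing BSD". Cell O1 (`p = 2`): research route; O1 OPEN; nothing booked; no mark / label / count
moved. Pure combinatorics of lens-2's normal form (x11b3-p4's vocabulary file
`X5/SelmerSolitaire.lean`, p272248, IMPORTED — nothing of it re-declared); reach-neutral; nothing
arithmetic is asserted. Plumbing DEFINITIONS (`unNew`, `extEntry`, `extend`) + theorems; no named
fact, no `sorry`.

WHAT THIS FILE IS (o1 PROVER ORDER v2.8 (ii′), second hand x11b3-p2, split agreed with x11b3-p4):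
the MOVE of the solitaire made explicit. `extend P N : Position (s + 1)` adjoins the new vertex
`q = some (Fin.last s)` to `P : Position s` with neighbourhood indicator `N : V s → ZMod 2`
(old–old entries `P.S`, new–old / old–new entries `N`, new–new entry `0`), through the decoding
equivalence `unNew : V (s+1) ≃ Option (V s)` (new vertex ↦ `none`, `oldV v ↦ some v`).

* §1 `unNew`, `unNew_oldV`, `unNew_new`, `oldV_injective`, `oldV_ne_new`.
* §2 `extEntry`, `extend`, the entry lemmas `extend_S_oldV_oldV` / `extend_S_new_oldV` /
  `extend_S_oldV_new` / `extend_S_new_new`, **`extend_extends : Extends P (extend P N)`**,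
  `extend_S_update_of_ne` (entries away from an updated vertex are unchanged),
  `mulVec_extend_update` (hence so is `Ŝ' κ` at such rows for `κ` vanishing there),
  `det_extend_image_oldV` (old principal minors of `extend P N` are those of `P`).
* §3 the core sets of the extended cube: **`plus_withNew_eq`**
  (`(T ∪ {q})⁺ = {q} ∪ oldV '' T^co`, `T^co = T ∪ {∞ iff |T| even}`), `plus_withNew_eq_of_mem`
  (`b ∈ B`: `= {q, oldV b} ∪ oldV '' (B ∖ b)⁺`), `plus_withNew_eq_of_even`
  (`|B|` even: `= {q, oldV ∞} ∪ oldV '' B⁺`), and **`core_extend_update_iff`** (updating `N` at a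
  prime outside `T` does not change `Core (extend P N) (withNew T)`).

References: lens-2 GEN 5 addendum G5.2–G5.3, G5.10 (`HOME/b2b-bsdres-o1-idea-2-g5/`).
-/

namespace Summit.BirchSwinnertonDyer.Rank1Residual.X5.SelmerSolitaire

open Finset Matrix

variable {s : ℕ}

/-! ### §1 Decoding the vertices of a one-vertex extension -/

/-- **Decoding equivalence** `V (s+1) ≃ Option (V s)`: the new vertex `some (Fin.last s)` ↦ `none`,
an old vertex `oldV v` ↦ `some v` (plumbing definition). [folklore] -/
def unNew : V (s + 1) ≃ Option (V s) :=
  (Equiv.optionCongr finSuccEquivLast).trans (Equiv.swap none (some none))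

/-- `unNew (oldV v) = some v`. [folklore] -/
@[simp] theorem unNew_oldV (v : V s) : unNew (oldV v) = some v := by
  cases v with
  | none => simp [unNew, oldV]
  | some i =>
    simp only [unNew, oldV, Option.map_some, Equiv.trans_apply, Equiv.optionCongr_apply,
      finSuccEquivLast_castSucc]
    rw [Equiv.swap_apply_of_ne_of_ne] <;> simp

/-- `unNew` of the new vertex is `none`. [folklore] -/
@[simp] theorem unNew_new : unNew (some (Fin.last s) : V (s + 1)) = none := by
  simp [unNew]

/-- `unNew.symm (some v) = oldV v`. [folklore] -/
@[simp] theorem unNew_symm_some (v : V s) : unNew.symm (some v) = oldV v := by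
  rw [Equiv.symm_apply_eq, unNew_oldV]

/-- `unNew.symm none` is the new vertex. [folklore] -/
@[simp] theorem unNew_symm_none : (unNew.symm none : V (s + 1)) = some (Fin.last s) := by
  rw [Equiv.symm_apply_eq, unNew_new]

/-- `oldV` is injective. [folklore] -/
theorem oldV_injective : Function.Injective (oldV : V s → V (s + 1)) :=
  Option.map_injective (Fin.castSucc_injective s)

/-- An old vertex is not the new vertex. [folklore] -/
theorem oldV_ne_new (v : V s) : oldV v ≠ (some (Fin.last s) : V (s + 1)) := by
  intro h
  have := congrArg unNew h
  simp at this

/-- `unNew w = some v ⟺ w = oldV v`. [folklore] -/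
theorem unNew_eq_some_iff {w : V (s + 1)} {v : V s} : unNew w = some v ↔ w = oldV v := by
  rw [← unNew_symm_some, Equiv.eq_symm_apply]

/-! ### §2 The extension `extend P N` -/

/-- Entries of the extended adjacency matrix on decoded vertices: new–new `0`, new–old and old–new
`N`, old–old `P.S` (plumbing definition). [folklore] -/
def extEntry (P : Position s) (N : V s → ZMod 2) : Option (V s) → Option (V s) → ZMod 2
  | none, none => 0
  | none, some w => N w
  | some v, none => N v
  | some v, some w => P.S v w

/-- **The one-vertex extension of `P` with neighbourhood indicator `N`** (the MOVE of the solitaire: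
adjoin the prime `q = some (Fin.last s)` adjacent to exactly the old vertices `v` with `N v = 1`).
(lens-2 G5.2; plumbing definition.) [folklore] -/
def extend (P : Position s) (N : V s → ZMod 2) : Position (s + 1) where
  S := fun i j => extEntry P N (unNew i) (unNew j)
  symm := by
    refine Matrix.IsSymm.ext fun i j => ?_
    rcases hi : unNew i with _ | v <;> rcases hj : unNew j with _ | w <;> simp only [extEntry]
    exact P.symm.apply v w
  loopless := fun i => by
    rcases hi : unNew i with _ | v <;> simp only [extEntry]
    exact P.loopless v

/-- Unfolding the entries of `extend`. [folklore] -/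
theorem extend_S_apply (P : Position s) (N : V s → ZMod 2) (i j : V (s + 1)) :
    (extend P N).S i j = extEntry P N (unNew i) (unNew j) := rfl

/-- Old–old entries of the extension are those of `P`. [folklore] -/
@[simp] theorem extend_S_oldV_oldV (P : Position s) (N : V s → ZMod 2) (v w : V s) :
    (extend P N).S (oldV v) (oldV w) = P.S v w := by
  simp [extend_S_apply, extEntry]

/-- New–old entries of the extension are the neighbourhood indicator. [folklore] -/
@[simp] theorem extend_S_new_oldV (P : Position s) (N : V s → ZMod 2) (w : V s) :
    (extend P N).S (some (Fin.last s)) (oldV w) = N w := by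
  simp [extend_S_apply, extEntry]

/-- Old–new entries of the extension are the neighbourhood indicator. [folklore] -/
@[simp] theorem extend_S_oldV_new (P : Position s) (N : V s → ZMod 2) (v : V s) :
    (extend P N).S (oldV v) (some (Fin.last s)) = N v := by
  simp [extend_S_apply, extEntry]

/-- The new–new entry is `0`. [folklore] -/
@[simp] theorem extend_S_new_new (P : Position s) (N : V s → ZMod 2) :
    (extend P N).S (some (Fin.last s)) (some (Fin.last s)) = 0 := by
  simp [extend_S_apply, extEntry]

/-- **`extend P N` is a one-vertex extension of `P`** in the sense of the vocabulary (`Extends`).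
[folklore] -/
theorem extend_extends (P : Position s) (N : V s → ZMod 2) : Extends P (extend P N) :=
  fun v w => extend_S_oldV_oldV P N v w

/-- Entries away from the row/column of an updated old vertex `v₀` do not see the update.
[folklore] -/
theorem extend_S_update_of_ne (P : Position s) (N : V s → ZMod 2) {v₀ : V s} (t : ZMod 2)
    {i j : V (s + 1)} (hi : i ≠ oldV v₀) (hj : j ≠ oldV v₀) :
    (extend P (Function.update N v₀ t)).S i j = (extend P N).S i j := by
  rw [extend_S_apply, extend_S_apply]
  have hi' : ∀ v, unNew i = some v → v ≠ v₀ := fun v hv h => hi (unNew_eq_some_iff.mp (h ▸ hv))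
  have hj' : ∀ w, unNew j = some w → w ≠ v₀ := fun w hw h => hj (unNew_eq_some_iff.mp (h ▸ hw))
  rcases hu : unNew i with _ | v <;> rcases hw : unNew j with _ | w <;> simp only [extEntry]
  · rw [Function.update_of_ne (hj' w hw)]
  · rw [Function.update_of_ne (hi' v hu)]

/-- Hence `(Ŝ'κ)ᵢ` is unchanged by an update at `v₀` for rows `i ≠ oldV v₀` and `κ` vanishing at
`oldV v₀`. [folklore] -/
theorem mulVec_extend_update (P : Position s) (N : V s → ZMod 2) {v₀ : V s} (t : ZMod 2)
    {κ : V (s + 1) → ZMod 2} (hκ : κ (oldV v₀) = 0) {i : V (s + 1)} (hi : i ≠ oldV v₀) :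
    ((extend P (Function.update N v₀ t)).S *ᵥ κ) i = ((extend P N).S *ᵥ κ) i := by
  simp only [Matrix.mulVec, dotProduct]
  refine Finset.sum_congr rfl fun j _ => ?_
  by_cases hj : j = oldV v₀
  · rw [hj, hκ, mul_zero, mul_zero]
  · rw [extend_S_update_of_ne P N t hi hj]

/-- **Old principal minors of the extension are those of `P`**: for `Z ⊆ V s`,
`det Ŝ'[oldV '' Z] = det Ŝ[Z]`. [folklore] -/
theorem det_extend_image_oldV (P : Position s) (N : V s → ZMod 2) (Z : Finset (V s)) :
    ((extend P N).S.submatrix (Subtype.val : ↥(Z.image oldV) → V (s + 1)) Subtype.val).det =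
      (P.S.submatrix (Subtype.val : ↥Z → V s) Subtype.val).det := by
  classical
  set e : ↥Z ≃ ↥(Z.image oldV) := Equiv.ofBijective
    (fun z => ⟨oldV z, Finset.mem_image_of_mem oldV z.2⟩)
    ⟨fun z z' h => Subtype.ext (oldV_injective (congrArg Subtype.val h)), fun w => by
      obtain ⟨z, hz, hzw⟩ := Finset.mem_image.mp w.2
      exact ⟨⟨z, hz⟩, Subtype.ext hzw⟩⟩ with he
  rw [← Matrix.det_submatrix_equiv_self e]
  congr 1
  ext z z'
  simp [he, Matrix.submatrix_apply]

/-! ### §3 The core sets of the extended cube -/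

/-- Membership in `(T ∪ {q})⁺`: the new vertex, or `oldV v` for `v` in
`T^co = T ∪ {∞ iff |T| even}`. [folklore] -/
theorem plus_withNew_eq (T : Finset (Fin s)) :
    plus (withNew T) = insert (some (Fin.last s))
      ((if Even T.card then insert none (T.map Function.Embedding.some)
        else T.map Function.Embedding.some).image oldV) := by
  have hcard : (withNew T).card = T.card + 1 := by
    rw [withNew, lift, Finset.card_insert_of_notMem, Finset.card_map]
    simp [Finset.mem_map, Fin.castSucc_ne_last]
  have hpar : Even (withNew T).card ↔ ¬ Even T.card := by
    rw [hcard, Nat.even_add_one]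
  ext w
  simp only [plus, hpar]
  by_cases hT : Even T.card
  · simp only [hT, not_true_eq_false, if_false, if_true, Finset.mem_insert, Finset.mem_map,
      Finset.mem_image, Function.Embedding.some_apply, withNew, lift, Fin.castSuccEmb_apply]
    constructor
    · rintro (rfl | ⟨k, hk, rfl⟩)
      · exact Or.inr ⟨none, Or.inl rfl, rfl⟩
      · rcases hk with rfl | ⟨i, hi, rfl⟩
        · exact Or.inl rfl
        · exact Or.inr ⟨some i, Or.inr ⟨i, hi, rfl⟩, rfl⟩
    · rintro (rfl | ⟨v, hv, rfl⟩)
      · exact Or.inr ⟨Fin.last s, Or.inl rfl, rfl⟩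
      · rcases hv with rfl | ⟨i, hi, rfl⟩
        · exact Or.inl rfl
        · exact Or.inr ⟨Fin.castSucc i, Or.inr ⟨i, hi, rfl⟩, rfl⟩
  · simp only [hT, not_false_eq_true, if_true, if_false, Finset.mem_insert, Finset.mem_map,
      Finset.mem_image, Function.Embedding.some_apply, withNew, lift, Fin.castSuccEmb_apply]
    constructor
    · rintro ⟨k, hk, rfl⟩
      rcases hk with rfl | ⟨i, hi, rfl⟩
      · exact Or.inl rfl
      · exact Or.inr ⟨some i, ⟨i, hi, rfl⟩, rfl⟩
    · rintro (rfl | ⟨v, ⟨i, hi, rfl⟩, rfl⟩)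
      · exact ⟨Fin.last s, Or.inl rfl, rfl⟩
      · exact ⟨Fin.castSucc i, Or.inr ⟨i, hi, rfl⟩, rfl⟩

/-- For `b ∈ B`: `B^co = {some b} ∪ (B ∖ b)⁺` — peeling one prime flips the parity. [folklore] -/
theorem coplus_eq_insert_plus_erase {B : Finset (Fin s)} {b : Fin s} (hb : b ∈ B) :
    (if Even B.card then insert none (B.map Function.Embedding.some)
      else B.map Function.Embedding.some) = insert (some b) (plus (B.erase b)) := by
  have hcard : (B.erase b).card + 1 = B.card := Finset.card_erase_add_one hb
  have hpar : Even (B.erase b).card ↔ ¬ Even B.card := by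
    rw [← hcard, Nat.even_add_one, not_not]
  ext w
  simp only [plus, hpar]
  by_cases hB : Even B.card
  · simp only [hB, not_true_eq_false, if_false, if_true, Finset.mem_insert, Finset.mem_map,
      Finset.mem_erase, Function.Embedding.some_apply]
    constructor
    · rintro (rfl | ⟨i, hi, rfl⟩)
      · exact Or.inr (Or.inl rfl)
      · by_cases hib : i = b
        · exact Or.inl (by rw [hib])
        · exact Or.inr (Or.inr ⟨i, ⟨hib, hi⟩, rfl⟩)
    · rintro (rfl | rfl | ⟨i, ⟨-, hi⟩, rfl⟩)
      · exact Or.inr ⟨b, hb, rfl⟩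
      · exact Or.inl rfl
      · exact Or.inr ⟨i, hi, rfl⟩
  · simp only [hB, not_false_eq_true, if_true, if_false, Finset.mem_insert, Finset.mem_map,
      Finset.mem_erase, Function.Embedding.some_apply]
    constructor
    · rintro ⟨i, hi, rfl⟩
      by_cases hib : i = b
      · exact Or.inl (by rw [hib])
      · exact Or.inr ⟨i, ⟨hib, hi⟩, rfl⟩
    · rintro (rfl | ⟨i, ⟨-, hi⟩, rfl⟩)
      · exact ⟨b, hb, rfl⟩
      · exact ⟨i, hi, rfl⟩

/-- **`b ∈ B`: `(B ∪ {q})⁺ = {q, oldV b} ∪ oldV '' (B ∖ b)⁺`.** [folklore] -/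
theorem plus_withNew_eq_of_mem {B : Finset (Fin s)} {b : Fin s} (hb : b ∈ B) :
    plus (withNew B) = insert (some (Fin.last s))
      (insert (oldV (some b)) ((plus (B.erase b)).image oldV)) := by
  rw [plus_withNew_eq, coplus_eq_insert_plus_erase hb, Finset.image_insert]

/-- **`|B|` even: `(B ∪ {q})⁺ = {q, oldV ∞} ∪ oldV '' B⁺`.** [folklore] -/
theorem plus_withNew_eq_of_even {B : Finset (Fin s)} (hB : Even B.card) :
    plus (withNew B) = insert (some (Fin.last s))
      (insert (oldV none) ((plus B).image oldV)) := by
  rw [plus_withNew_eq, if_pos hB, Finset.image_insert, plus, if_pos hB]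

/-- Every vertex of `(T ∪ {q})⁺` other than an `oldV (some x)` with `x ∈ T` is the new vertex or
`oldV ∞`; in particular none of them is `oldV (some b)` for `b ∉ T`. [folklore] -/
theorem ne_oldV_some_of_mem_plus_withNew {T : Finset (Fin s)} {b : Fin s} (hb : b ∉ T)
    {w : V (s + 1)} (hw : w ∈ plus (withNew T)) : w ≠ oldV (some b) := by
  rw [plus_withNew_eq] at hw
  rcases Finset.mem_insert.mp hw with rfl | hw
  · exact (oldV_ne_new _).symm
  · obtain ⟨v, hv, rfl⟩ := Finset.mem_image.mp hw
    intro h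
    have hvb := oldV_injective h
    subst hvb
    split_ifs at hv with hT
    · rcases Finset.mem_insert.mp hv with h0 | hv
      · exact Option.some_ne_none _ h0
      · rw [show (some b : V s) = Function.Embedding.some b from rfl, Finset.mem_map'] at hv
        exact hb hv
    · rw [show (some b : V s) = Function.Embedding.some b from rfl, Finset.mem_map'] at hv
      exact hb hv

/-- **Updating the neighbourhood at a prime `b ∉ T` does not change `Core (extend P N) (T ∪ {q})`**
(the minor on `(T ∪ {q})⁺` does not meet the row/column `oldV b`). [folklore] -/
theorem core_extend_update_iff (P : Position s) (N : V s → ZMod 2) {T : Finset (Fin s)}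
    {b : Fin s} (hb : b ∉ T) (t : ZMod 2) :
    Core (extend P (Function.update N (some b) t)) (withNew T) ↔ Core (extend P N) (withNew T) := by
  have hM : (extend P (Function.update N (some b) t)).S.submatrix
        (fun x : ↥(plus (withNew T)) => (x : V (s + 1))) (fun x : ↥(plus (withNew T)) => (x : V (s + 1))) =
      (extend P N).S.submatrix
        (fun x : ↥(plus (withNew T)) => (x : V (s + 1))) (fun x : ↥(plus (withNew T)) => (x : V (s + 1))) := by
    ext i j
    exact extend_S_update_of_ne P N t (ne_oldV_some_of_mem_plus_withNew hb i.2)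
      (ne_oldV_some_of_mem_plus_withNew hb j.2)
  unfold Core
  rw [hM]

end Summit.BirchSwinnertonDyer.Rank1Residual.X5.SelmerSolitaire
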